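import Mathlib
import HarnessLib
import Summits.HubbardSuperconductivity.HubbardSuperconductivity.Theorems.KLProgrammeKLRegimeSplitPredicatesV3

/-!
# Route `KLProgramme` — crux K3 split: the ENGINE slot, VERSION 4 (`EngineBoundsAtV4`) — V3 plus the two β-placed or leg-placed second-order
# units no constant profile can carry (p1b's gating nod (T) thermal layer, (D) leg dressing) and (E1) for `p ≥ 2` only (p2's Δ8)
# (cell gate-hubbard-kl, seat p1 = C1 lead, g5; for p2's bundle `klPredsV4 := { klPredsV3 with renorm, twoLeg, engine := EngineBoundsAtV4 }`)

WHY (HOME/STATUS p1b 12:02:13Z, p2 12:06:27Z, p1 12:2xZ).  (T) THERMAL LAYER: at the last two scales `n ∈ {n_β − 1, n_β}` the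
zero-transfer single-slice particle–hole bubble is `O(1)` (the discrete Matsubara sum breaks E.2's `(k₀, ξ)`-rotation cancellation), so
the forward value increment there is `≍ U²`; its PLACEMENT depends on `β`, and `G` is fixed before `β` — no `G.phGain n 0` with
`Σ_n ≤ CF` can carry it.  (D) LEG DRESSING: the carrier `klEffectiveAction = effAction …` (D1) is the CONNECTED-AMPUTATED (Wilsonian)
action, not 1PI; the value clauses of V3 quantify over the WHOLE ultraviolet ball, and an external leg with `|e_K(k_i)|` above the
current scale carries the one-particle-reducible dressing `U · C^K_{>Λ_n}(k_i) · W₂^{(n)}(k_i)` (value `O(U²)`, harmless), whose scale-`n`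
INCREMENT is `≍ U²` exactly when `|e_K(k_i)|` crosses slice `n` — independently of the three transfers, so not under `gainBar`.
Both are additive `O((Klam U)²)` terms with bounded sums over `n` (`≤ (4/3)·CF·(Klam U)²`, `≤ 20·CF·(Klam U)²`), absorbed by child 1's
`C_W`; the SPLIT slot `BetaSplitAtV3` is unchanged.  (E1) at `p = 1` is dropped from the engine slot (the two-leg kernel contains the
frame vertex, whose size is `R`-dependent while `Q` is chosen before `R` — Δ8; the two-leg line is (E3)/`TwoLegStepV2`'s).
Definitions with bodies only; nothing about the model is asserted.
-/

noncomputable section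

namespace Summit.HubbardSuperconductivity.HubbardSuperconductivity.Theorems.KLRegimeSplit

set_option linter.dupNamespace false -- summit = problem name (single-conjunct summit), D-0017

open Real Finset Literature.MathematicalPhysics.QuantumLattice Literature.Probability.LatticeModels
open Summit.HubbardSuperconductivity.HubbardSuperconductivity.Theorems.KLProgrammeLegKernels

/-! ## §1 The two new majorants -/

/-- **(T) the thermal-layer majorant** `CF·(Klam U)²·4^{-(n_β − n)}` (ℕ-subtraction: `= CF·(Klam U)²` at and above the last scale,
geometrically small below; `Σ_{n ≤ n_β} ≤ (4/3)·CF·(Klam U)²`). -/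
def thermalBar (G : GeoConsts) (P : SplitConsts) (U β : ℝ) (n : ℕ) : ℝ :=
  G.CF * (P.Klam * U) ^ 2 * ((4 : ℝ) ^ (nScales β - n))⁻¹

section Model

variable (L M : ℕ) [NeZero L] [NeZero M]

/-- **The number of external legs crossing slice `n`**: legs `i` whose frame energy `|e_K(k_i)|` lies in `[Λ_{n+2}, Λ_{n-2}]`
(each leg crosses at most five slices as `n` runs). -/
def legSliceCount (μ : ℝ) (K : TrigPolyC4v) (n : ℕ) (k : Fin 4 → TorusSite 2 L) : ℕ :=
  (Finset.univ.filter fun i : Fin 4 =>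
      klScale klE0 (n + 2) ≤ |nambuXiCT L μ K (k i)| ∧ |nambuXiCT L μ K (k i)| ≤ klScale klE0 (n - 2)).card

end Model

/-- **(D) the leg-dressing majorant** `CF·(Klam U)²·#(crossing legs)` (`Σ_n ≤ 20·CF·(Klam U)²` per configuration). -/
def legDressBar (G : GeoConsts) (P : SplitConsts) (U : ℝ) (c : ℕ) : ℝ := G.CF * (P.Klam * U) ^ 2 * c

/-! ## §2 The V4 engine clauses -/

section Model

variable (L M : ℕ) [NeZero L] [NeZero M]

/-- **(E1-v4) kernel norms for `p ≥ 2`** (the two-leg line is (E3)'s): `‖W_{2p}‖_{1,aniso} ≤ CE^p · ε_n^{p-1} · 2^{(3p-5)n}`,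
`ε_n = epsCoupling P U n`. -/
def KernelNormsV4 (P : SplitConsts) (Q : EngConsts) (β U μ : ℝ) (K : TrigPolyC4v) (n : ℕ) : Prop :=
  ∀ p : ℕ, 2 ≤ p →
    klAnisoLegKernelNorm L M β U μ K klE0 n (2 * p) ≤
      Q.CE ^ p * (epsCoupling P U n) ^ (p - 1) * (2 : ℝ) ^ ((3 * (p : ℤ) - 5) * n)

/-- **(E2-v4) the one-step ladder identity with remainder** — `PairLadderStepAtV3` with the remainder enlarged by
`thermalBar … β n + legDressBar … (legSliceCount … n (k′, Q−k′, Q−k, k))`. -/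
def PairLadderStepAtV4 (G : GeoConsts) (P : SplitConsts) (Q : EngConsts) (β U μ : ℝ) (K : TrigPolyC4v) (n : ℕ) : Prop :=
  (n = 0 → ∀ Qm : TorusSite 2 L, ∀ k ∈ klBall L μ K, ∀ k' ∈ klBall L μ K,
      ‖klPairAmplitude L M β U μ K 0 Qm k k' - (U : ℂ)‖ ≤ initDevBar G U) ∧
  (1 ≤ n → ∀ Qm : TorusSite 2 L, IsPairClassAt L Qm n →
      ∃ w : TorusSite 2 L → ℝ, (∀ p, 0 ≤ w p) ∧ (∑ p, w p ≤ G.bhi) ∧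
        ∃ N : Matrix (TorusSite 2 L) (TorusSite 2 L) ℂ,
          (1 + Matrix.diagonal (fun p => (w p : ℂ)) * klPairArray L M β U μ K (n - 1) Qm) * N = 1 ∧
          ∀ k ∈ klBall L μ K, ∀ k' ∈ klBall L μ K,
            ‖klPairAmplitude L M β U μ K n Qm k k' - (klPairArray L M β U μ K (n - 1) Qm * N) k k'‖ ≤
              drivePBar G P U (n - 1) + eremBar G P Q U β L (n - 1) + thermalBar G P U β n +
                legDressBar G P U (legSliceCount L μ K n ![k', Qm - k', Qm - k, k]))

/-- **(E2″-v4) value increments of the pair arrays** — `PairValueIncrementAt` `+ thermalBar + legDressBar`. -/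
def PairValueIncrementAtV4 (G : GeoConsts) (P : SplitConsts) (Q : EngConsts) (β U μ : ℝ) (K : TrigPolyC4v) (n : ℕ) : Prop :=
  1 ≤ n → ∀ Qm : TorusSite 2 L, ∀ k ∈ klBall L μ K, ∀ k' ∈ klBall L μ K,
    ‖klPairAmplitude L M β U μ K n Qm k k' - klPairAmplitude L M β U μ K (n - 1) Qm k k'‖ ≤
      gainBar G P U n (klTorusNorm L Qm) (klTorusNorm L (k - k')) (klTorusNorm L (k + k' - Qm)) +
        eremBar G P Q U β L (n - 1) + thermalBar G P U β n +
          legDressBar G P U (legSliceCount L μ K n ![k', Qm - k', Qm - k, k])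

/-- **(E2′-v4) pointwise increments of the running coupling values at the TRUE transfers** — `QuarticValueIncrementAt`
`+ thermalBar + legDressBar` (legs `(k₁, k₂, k₃, k₁−k₂+k₃)`). -/
def QuarticValueIncrementAtV4 (G : GeoConsts) (P : SplitConsts) (Q : EngConsts) (β U μ : ℝ) (K : TrigPolyC4v) (n : ℕ) :
    Prop :=
  1 ≤ n → ∀ (σ σ' : Fin 2), ∀ k₁ ∈ klBall L μ K, ∀ k₂ ∈ klBall L μ K, ∀ k₃ ∈ klBall L μ K,
    ‖klQuarticValue L M β U μ K n σ σ' k₁ k₂ k₃ - klQuarticValue L M β U μ K (n - 1) σ σ' k₁ k₂ k₃‖ ≤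
      gainBar G P U n (klTorusNorm L (k₁ + k₃)) (klTorusNorm L (k₁ - k₂)) (klTorusNorm L (k₂ - k₃)) +
        eremBar G P Q U β L (n - 1) + thermalBar G P U β n +
          legDressBar G P U (legSliceCount L μ K n ![k₁, k₂, k₃, k₁ - k₂ + k₃])

/-- **`EngineBoundsAtV4 … G P Q K n`** = (E0) ∧ (E1-v4) ∧ (E2-v4) ∧ (E2″-v4) ∧ (E2′-v4 + UV clause) ∧ (E4) ∧ (E5-v3).
Same slot type as `Preds.engine`; for p2's bundle `klPredsV4`. -/
def EngineBoundsAtV4 (G : GeoConsts) (P : SplitConsts) (Q : EngConsts) (β U μ : ℝ) (K : TrigPolyC4v) (n : ℕ) : Prop :=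
  SelfEnergySymmetric L M β U μ K n ∧ KernelNormsV4 L M P Q β U μ K n ∧
    PairLadderStepAtV4 L M G P Q β U μ K n ∧ PairValueIncrementAtV4 L M G P Q β U μ K n ∧
      QuarticValueIncrementAtV4 L M G P Q β U μ K n ∧ QuarticValueUVAt L M G β U μ K n ∧
        EngineFirstMoments L M G P Q β U μ K n ∧ IsoTupleL1At L M G P β U μ K n

/-! ## §3 Bookkeeping -/

omit [NeZero L] [NeZero M] in
/-- At most four legs cross any slice. -/
theorem legSliceCount_le_four (μ : ℝ) (K : TrigPolyC4v) (n : ℕ) (k : Fin 4 → TorusSite 2 L) :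
    legSliceCount L μ K n k ≤ 4 :=
  (Finset.card_filter_le _ _).trans (by simp)

/-- V3's ladder step implies V4's (the V4 remainder is larger): provers who establish the sharper V3 clause get V4 for free. -/
theorem pairLadderStepAtV4_of_v3 {G : GeoConsts} {P : SplitConsts} {Q : EngConsts} (hG : 0 ≤ G.CF) {β U μ : ℝ}
    {K : TrigPolyC4v} {n : ℕ} (h : PairLadderStepAtV3 L M G P Q β U μ K n) : PairLadderStepAtV4 L M G P Q β U μ K n := by
  refine ⟨h.1, fun hn Qm hQ => ?_⟩
  obtain ⟨w, hw, hmass, N, hN, hb⟩ := h.2 hn Qm hQ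
  refine ⟨w, hw, hmass, N, hN, fun k hk k' hk' => (hb k hk k' hk').trans ?_⟩
  have h1 : 0 ≤ thermalBar G P U β n := by unfold thermalBar; positivity
  have h2 : 0 ≤ legDressBar G P U (legSliceCount L μ K n ![k', Qm - k', Qm - k, k]) := by unfold legDressBar; positivity
  linarith

end Model

/-- The thermal-layer majorant is nonnegative. -/
theorem thermalBar_nonneg {G : GeoConsts} (hG : 0 ≤ G.CF) (P : SplitConsts) (U β : ℝ) (n : ℕ) : 0 ≤ thermalBar G P U β n := by
  unfold thermalBar; positivity

/-- The leg-dressing majorant is nonnegative. -/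
theorem legDressBar_nonneg {G : GeoConsts} (hG : 0 ≤ G.CF) (P : SplitConsts) (U : ℝ) (c : ℕ) : 0 ≤ legDressBar G P U c := by
  unfold legDressBar; positivity

end Summit.HubbardSuperconductivity.HubbardSuperconductivity.Theorems.KLRegimeSplit

end
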